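import Summits.CriticalPhenomena.PercolationContinuityZ3.Theorems.PercNearOneGluingNoHeavyLowerTailRepellerFrameExchange
import HarnessLib

/-!
# `NoHeavyLowerTail` (stmt-CriticalPhenomena-4575) — repeller-frame COVARIANCE rows for the flat observer event `E♭`
# (depth prover `nh-dp-commonrelay`, gen 9)

Support file (`--supports stmt-CriticalPhenomena-4575`); no definitions, no named facts, no sorries.  Continues
`…RepellerFrameExchange` (gen 8), whose exchange theorem `sre_exchangeEflat` (ZX♭) compares the two `b`-worlds.  Here we land the two
COVARIANCE forms of the same repeller-frame argument, for the event
  `E♭ := {a₁ ↔ o} ∪ ({a₂ ↔ o} ∩ {a₂ ↮ a₃})`   ("the observer reaches the source, or reaches the second source off the repeller's cluster")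
on the van den Berg–Häggström–Kahn world `R = {a₁ ↮ a₃}`:

* `sre_covEflatSource`:   `μ(E♭ ∩ R) · μ(R ∩ {a₁↔b}) ≤ μ(R) · μ(E♭ ∩ R ∩ {a₁↔b})`, i.e. `Cov(1_{E♭}, 1{b ∈ C(a₁)} | R) ≥ 0`;
* `sre_covEflatRepeller`: `μ(R) · μ(E♭ ∩ R ∩ {a₃↔b}) ≤ μ(R ∩ {a₃↔b}) · μ(E♭ ∩ R)`, i.e. `Cov(1_{E♭}, 1{b ∈ C(a₃)} | R) ≤ 0`.

PROOF (same frame as ZX♭).  Condition on the open edge cluster `W = C_{a₃}`; on `R` the configuration off `W̄` is fresh, `E♭ = {o ↔ {a₁,a₂} off W̄}`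
and `{a₁↔b} = {a₁ ↔ b off W̄}` are increasing events of the fresh variables — Harris gives `P(E♭ ∩ {a₁↔b} | C_{a₃} = W) ≥ e(W) β(W)` — and
`e`, `β` are DECREASING in `W` while `1{b ∈ V(W)}` is increasing; BHK Thm 1.3 for `C_{a₃}` given `a₃ ↮ a₁` gives `⟨eβ⟩⟨1⟩ ≥ ⟨e⟩⟨β⟩` and
`⟨1⟩⟨τe⟩ ≤ ⟨τ⟩⟨e⟩`.  (This is van den Berg–Häggström–Kahn's Theorem 1.5 with the roles `(s,t) = (a₃,a₁)`, for the COMPOUND complement-connectivity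
event `E♭`, which is not a monotone function of a single cluster.)

ROLE.  With `F1 := {a₂ ∉ C(a₁), o ∈ C(a₂)}` and `G := {o, a₂ ∈ C(a₃)}` one has `1{o ∈ C(a₁)} = 1_{E♭} − 1_{F1} + 1_G` on `R`, and the
registered hypothesis-free rows (K\*g), (K\*t), (Y13) of this line split as `S_E + S_F + Cov(G,·)` / `ZX + Fex − dG` with `S_E` = the present
covariance rows, `S_F`, `Fex ≥ 0` by BHK Thm 1.4 on `{a₁ ↮ a₂,a₃}`, and the `G`-term the only adverse one (memo RESIDUAL-gen9.md §3).  The present rows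
are also PROVED inequalities outside the two-set/Harris certificate cone used for KN Question 7 at `|A| = 3` (they cut the published U13 pseudo-laws;
memo §5).
[cite: VandenbergHaggstromKahn2005, Thm. 1.3 (p. 6), Thm. 1.5 (p. 7), §1 pp. 7–8 (display (10)); KozmaNitzan2024, Question 7 (p. 36)]
-/

namespace Summit.CriticalPhenomena.PercolationContinuityZ3.Theorems

open MeasureTheory Set Literature.Probability.LatticeModels Literature.Probability.Percolation
open Literature.Probability.Percolation.BHK2006 Literature.Probability.Percolation.DecisionTree

noncomputable section

open Classical

variable {n : ℕ}

/-- **Repeller-frame covariance rows for `E♭` (both signs), division-free.**  With `E♭ = {a₁↔o} ∪ ({a₂↔o} ∩ {a₂↮a₃})` and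
`R = {a₁ ↮ a₃}`:
(1) `μ(E♭ ∩ R) · μ(R ∩ {a₁↔b}) ≤ μ(R) · μ(E♭ ∩ R ∩ {a₁↔b})`  (`E♭` and `{b ∈ C(a₁)}` are positively correlated given `R`);
(2) `μ(R) · μ(E♭ ∩ R ∩ {a₃↔b}) ≤ μ(R ∩ {a₃↔b}) · μ(E♭ ∩ R)`  (`E♭` and `{b ∈ C(a₃)}` are negatively correlated given `R`).
Repeller frame (`sre_sum_cond_gen`), Harris in the fresh variables, BHK Thm 1.3 twice for `C_{a₃}` given `a₃ ↮ a₁`.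
[cite: VandenbergHaggstromKahn2005, Thm. 1.3 (p. 6), Thm. 1.5 (p. 7), §1 display (10)] -/
theorem sre_covEflat (w : Sym2 (Fin n) → unitInterval) (o b a₁ a₂ a₃ : Fin n) (h13 : a₁ ≠ a₃) (ho2 : o ≠ a₂) :
    (prodBernoulli w).real ((openConn a₁ o ∪ (openConn a₂ o ∩ (openConn a₂ a₃)ᶜ)) ∩ (openConn a₁ a₃)ᶜ) *
          (prodBernoulli w).real ((openConn a₁ a₃)ᶜ ∩ openConn a₁ b) ≤
        (prodBernoulli w).real ((openConn a₁ a₃)ᶜ : Set (BondConfig (Fin n))) *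
          (prodBernoulli w).real ((openConn a₁ o ∪ (openConn a₂ o ∩ (openConn a₂ a₃)ᶜ)) ∩ (openConn a₁ a₃)ᶜ ∩ openConn a₁ b) ∧
      (prodBernoulli w).real ((openConn a₁ a₃)ᶜ : Set (BondConfig (Fin n))) *
          (prodBernoulli w).real ((openConn a₁ o ∪ (openConn a₂ o ∩ (openConn a₂ a₃)ᶜ)) ∩ (openConn a₁ a₃)ᶜ ∩ openConn a₃ b) ≤
        (prodBernoulli w).real ((openConn a₁ a₃)ᶜ ∩ openConn a₃ b) *
          (prodBernoulli w).real ((openConn a₁ o ∪ (openConn a₂ o ∩ (openConn a₂ a₃)ᶜ)) ∩ (openConn a₁ a₃)ᶜ) := by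
  classical
  -- the finite-sum world
  set w' : Sym2 (Fin n) → ℝ := fun e => (w e : ℝ) with hw'
  have hw0 : ∀ e, 0 ≤ w' e := fun e => (w e).2.1
  have hw1 : ∀ e, w' e ≤ 1 := fun e => (w e).2.2
  have hm : ∑ ω, weight w' ω = 1 := by
    have h1 := integral_prodBernoulli_eq_sum w fun _ => (1 : ℝ)
    simp only [integral_const, probReal_univ, smul_eq_mul, mul_one] at h1
    exact h1.symm
  have hreal : ∀ X : Set (BondConfig (Fin n)), (prodBernoulli w).real X = ∑ ω, weight w' ω * ind X ω := by
    intro X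
    rw [← integral_indicator_one (MeasurableSet.of_discrete (s := X)), integral_prodBernoulli_eq_sum]
    refine Finset.sum_congr rfl fun ω _ => ?_
    by_cases hω : ω ∈ X
    · rw [Set.indicator_of_mem hω, ind_of_mem hω, Pi.one_apply]
    · rw [Set.indicator_of_notMem hω, ind_of_not_mem hω, mul_zero]
  set D : Set (BondConfig (Fin n)) := {ω | ∀ x ∈ ({a₁} : Set (Fin n)), ¬ (openGraph ω).Reachable a₃ x} with hD
  have hDmem : ∀ ω, ω ∈ D ↔ ¬ (openGraph ω).Reachable a₃ a₁ := fun ω => by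
    simp only [hD, Set.mem_setOf_eq, Set.mem_singleton_iff, forall_eq]
  have hint : ∀ h : Set (Sym2 (Fin n)) → ℝ,
      ∫ ω in D, h ω ∂(prodBernoulli w) = ∑ ω, weight w' ω * (h ω * ind D ω) := by
    intro h
    rw [← integral_indicator (MeasurableSet.of_discrete (s := D)), integral_prodBernoulli_eq_sum]
    refine Finset.sum_congr rfl fun ω _ => ?_
    by_cases hω : ω ∈ D
    · rw [Set.indicator_of_mem hω, ind_of_mem hω, mul_one]
    · rw [Set.indicator_of_notMem hω, ind_of_not_mem hω]; ring
  -- the functions of the repeller frame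
  set fB : Set (Sym2 (Fin n)) → ℝ := ind (openConn a₁ b : Set (BondConfig (Fin n))) with hfB
  set fE : Set (Sym2 (Fin n)) → ℝ := ind (openConn a₁ o ∪ openConn a₂ o : Set (BondConfig (Fin n))) with hfE
  set τ : Set (Sym2 (Fin n)) → ℝ := ind {W : Set (Sym2 (Fin n)) | b = a₃ ∨ ∃ e ∈ W, b ∈ e} with hτ
  set dD : Set (Sym2 (Fin n)) → ℝ := ind {W : Set (Sym2 (Fin n)) | ¬ (a₁ = a₃ ∨ ∃ e ∈ W, a₁ ∈ e)} with hdD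
  set β : Set (Sym2 (Fin n)) → ℝ := fun W =>
    ∑ η, weight w' η * fB (η \ {e | ∃ v ∈ e, v = a₃ ∨ ∃ e' ∈ W, v ∈ e'}) with hβ
  set eE : Set (Sym2 (Fin n)) → ℝ := fun W =>
    ∑ η, weight w' η * fE (η \ {e | ∃ v ∈ e, v = a₃ ∨ ∃ e' ∈ W, v ∈ e'}) with heE
  -- monotonicity
  have hfBm : Monotone fB := sre_ind_mono_of_isUpperSet (isUpperSet_openConn a₁ b)
  have hfEm : Monotone fE :=
    sre_ind_mono_of_isUpperSet ((isUpperSet_openConn a₁ o).union (isUpperSet_openConn a₂ o))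
  have hbarm := bar_mono (V := Fin n) a₃
  have hβa : Antitone β := by
    intro W W' hWW'
    refine Finset.sum_le_sum fun η _ => mul_le_mul_of_nonneg_left ?_ (weight_nonneg hw0 hw1 η)
    exact hfBm (Set.sdiff_subset_sdiff_right (hbarm hWW'))
  have hea : Antitone eE := by
    intro W W' hWW'
    refine Finset.sum_le_sum fun η _ => mul_le_mul_of_nonneg_left ?_ (weight_nonneg hw0 hw1 η)
    exact hfEm (Set.sdiff_subset_sdiff_right (hbarm hWW'))
  have hτm : Monotone τ := by
    refine sre_ind_mono_of_isUpperSet ?_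
    rintro W W' hWW' (h | ⟨e, he, hbe⟩)
    · exact Or.inl h
    · exact Or.inr ⟨e, hWW' he, hbe⟩
  have hβle : ∀ W, β W ≤ 1 := fun W => by
    calc β W ≤ ∑ η, weight w' η * 1 :=
          Finset.sum_le_sum fun η _ => mul_le_mul_of_nonneg_left (ind_le_one _ _) (weight_nonneg hw0 hw1 η)
      _ = 1 := by rw [← Finset.sum_mul, hm, one_mul]
  have hele : ∀ W, eE W ≤ 1 := fun W => by
    calc eE W ≤ ∑ η, weight w' η * 1 :=
          Finset.sum_le_sum fun η _ => mul_le_mul_of_nonneg_left (ind_le_one _ _) (weight_nonneg hw0 hw1 η)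
      _ = 1 := by rw [← Finset.sum_mul, hm, one_mul]
  have hβ0 : ∀ W, 0 ≤ β W := fun W => Finset.sum_nonneg fun η _ => mul_nonneg (weight_nonneg hw0 hw1 η) (ind_nonneg _ _)
  have he0 : ∀ W, 0 ≤ eE W := fun W => Finset.sum_nonneg fun η _ => mul_nonneg (weight_nonneg hw0 hw1 η) (ind_nonneg _ _)
  -- pointwise identities on the repeller frame
  have hdpt : ∀ ω : BondConfig (Fin n), ind D ω = dD (openEdgeCluster ω a₃) := fun ω =>
    BystanderBHK.ind_congr (by rw [hDmem, reachable_iff_exists_mem_openEdgeCluster]; rfl)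
  have hTpt : ∀ ω : BondConfig (Fin n), ind (openConn a₃ b : Set (BondConfig (Fin n))) ω = τ (openEdgeCluster ω a₃) :=
    fun ω => BystanderBHK.ind_congr (by
      show (openGraph ω).Reachable a₃ b ↔ _
      rw [reachable_iff_exists_mem_openEdgeCluster]; rfl)
  have hBpt : ∀ ω : BondConfig (Fin n), ω ∈ D →
      ind (openConn a₁ b : Set (BondConfig (Fin n))) ω =
        fB (ω \ {e | ∃ v ∈ e, v = a₃ ∨ ∃ e' ∈ openEdgeCluster ω a₃, v ∈ e'}) := fun ω hω =>
    BystanderBHK.ind_congr (sre_reach_off_bar ω a₃ a₁ b ((hDmem ω).1 hω))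
  have hEpt : ∀ ω : BondConfig (Fin n), ω ∈ D →
      ind ((openConn a₁ o ∪ (openConn a₂ o ∩ (openConn a₂ a₃)ᶜ)) : Set (BondConfig (Fin n))) ω =
        fE (ω \ {e | ∃ v ∈ e, v = a₃ ∨ ∃ e' ∈ openEdgeCluster ω a₃, v ∈ e'}) := fun ω hω =>
    BystanderBHK.ind_congr (by
      simp only [Set.mem_union, Set.mem_inter_iff, Set.mem_compl_iff]
      show ((openGraph ω).Reachable a₁ o ∨ ((openGraph ω).Reachable a₂ o ∧ ¬ (openGraph ω).Reachable a₂ a₃)) ↔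
        ((openGraph _).Reachable a₁ o ∨ (openGraph _).Reachable a₂ o)
      rw [sre_reach_off_bar ω a₃ a₁ o ((hDmem ω).1 hω), sre_reach₂_off_bar ω a₃ a₂ o ho2])
  -- the measures as sums over the repeller frame
  have hRD : ((openConn a₁ a₃)ᶜ : Set (BondConfig (Fin n))) = D := by
    ext ω
    rw [hDmem, Set.mem_compl_iff]
    exact ⟨fun h h' => h h'.symm, fun h h' => h h'.symm⟩
  have hsplit : ∀ (X Y : Set (BondConfig (Fin n))) (ω : BondConfig (Fin n)),
      ind (X ∩ (openConn a₁ a₃)ᶜ ∩ Y) ω = ind X ω * ind Y ω * ind D ω := by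
    intro X Y ω
    rw [ind_inter, ind_inter, hRD]; ring
  have hsplit' : ∀ (Y : Set (BondConfig (Fin n))) (ω : BondConfig (Fin n)),
      ind ((openConn a₁ a₃)ᶜ ∩ Y) ω = ind Y ω * ind D ω := by
    intro Y ω
    rw [ind_inter, hRD]; ring
  have hsplit0 : ∀ (X : Set (BondConfig (Fin n))) (ω : BondConfig (Fin n)),
      ind (X ∩ (openConn a₁ a₃)ᶜ) ω = ind X ω * ind D ω := by
    intro X ω
    rw [ind_inter, hRD]
  -- μ(E♭ ∩ R ∩ T) = Σ (τ · e)(C₃) 1_D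
  have hM1 : (prodBernoulli w).real ((openConn a₁ o ∪ (openConn a₂ o ∩ (openConn a₂ a₃)ᶜ)) ∩ (openConn a₁ a₃)ᶜ ∩ openConn a₃ b) =
      ∑ ω, weight w' ω * ((τ (openEdgeCluster ω a₃) * eE (openEdgeCluster ω a₃)) * ind D ω) := by
    rw [hreal]
    have step : ∀ ω : BondConfig (Fin n),
        weight w' ω * ind ((openConn a₁ o ∪ (openConn a₂ o ∩ (openConn a₂ a₃)ᶜ)) ∩ (openConn a₁ a₃)ᶜ ∩ openConn a₃ b) ω =
        weight w' ω * ((τ (openEdgeCluster ω a₃) * fE (ω \ {e | ∃ v ∈ e, v = a₃ ∨ ∃ e' ∈ openEdgeCluster ω a₃, v ∈ e'})) *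
          dD (openEdgeCluster ω a₃)) := by
      intro ω
      rw [hsplit]
      by_cases hω : ω ∈ D
      · rw [hEpt ω hω, hTpt ω, ← hdpt ω]; ring
      · rw [← hdpt ω, ind_of_not_mem hω]; ring
    rw [Finset.sum_congr rfl fun ω _ => step ω,
      sre_sum_cond_gen w' hm a₃ (fun W ζ => (τ W * fE ζ) * dD W)]
    refine Finset.sum_congr rfl fun ω _ => ?_
    rw [hdpt ω]
    simp only [heE, Finset.mul_sum, Finset.sum_mul]
    exact Finset.sum_congr rfl fun η _ => by ring
  -- μ(E♭ ∩ R) = Σ e(C₃) 1_D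
  have hM0 : (prodBernoulli w).real ((openConn a₁ o ∪ (openConn a₂ o ∩ (openConn a₂ a₃)ᶜ)) ∩ (openConn a₁ a₃)ᶜ) =
      ∑ ω, weight w' ω * (eE (openEdgeCluster ω a₃) * ind D ω) := by
    rw [hreal]
    have step : ∀ ω : BondConfig (Fin n),
        weight w' ω * ind ((openConn a₁ o ∪ (openConn a₂ o ∩ (openConn a₂ a₃)ᶜ)) ∩ (openConn a₁ a₃)ᶜ) ω =
        weight w' ω * (fE (ω \ {e | ∃ v ∈ e, v = a₃ ∨ ∃ e' ∈ openEdgeCluster ω a₃, v ∈ e'}) *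
          dD (openEdgeCluster ω a₃)) := by
      intro ω
      rw [hsplit0]
      by_cases hω : ω ∈ D
      · rw [hEpt ω hω, ← hdpt ω]
      · rw [← hdpt ω, ind_of_not_mem hω]; ring
    rw [Finset.sum_congr rfl fun ω _ => step ω, sre_sum_cond_gen w' hm a₃ (fun W ζ => fE ζ * dD W)]
    refine Finset.sum_congr rfl fun ω _ => ?_
    rw [hdpt ω]
    simp only [heE, Finset.mul_sum, Finset.sum_mul]
    exact Finset.sum_congr rfl fun η _ => by ring
  -- μ(R ∩ B) = Σ β(C₃) 1_D
  have hM2 : (prodBernoulli w).real ((openConn a₁ a₃)ᶜ ∩ openConn a₁ b) =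
      ∑ ω, weight w' ω * (β (openEdgeCluster ω a₃) * ind D ω) := by
    rw [hreal]
    have step : ∀ ω : BondConfig (Fin n), weight w' ω * ind ((openConn a₁ a₃)ᶜ ∩ openConn a₁ b) ω =
        weight w' ω * (fB (ω \ {e | ∃ v ∈ e, v = a₃ ∨ ∃ e' ∈ openEdgeCluster ω a₃, v ∈ e'}) * dD (openEdgeCluster ω a₃)) := by
      intro ω
      rw [hsplit']
      by_cases hω : ω ∈ D
      · rw [hBpt ω hω, ← hdpt ω]
      · rw [← hdpt ω, ind_of_not_mem hω]; ring
    rw [Finset.sum_congr rfl fun ω _ => step ω, sre_sum_cond_gen w' hm a₃ (fun W ζ => fB ζ * dD W)]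
    refine Finset.sum_congr rfl fun ω _ => ?_
    rw [hdpt ω]
    simp only [hβ, Finset.mul_sum, Finset.sum_mul]
    exact Finset.sum_congr rfl fun η _ => by ring
  -- μ(E♭ ∩ R ∩ B) ≥ Σ (β e)(C₃) 1_D   (Harris in the fresh variables)
  have hM3 : ∑ ω, weight w' ω * ((β (openEdgeCluster ω a₃) * eE (openEdgeCluster ω a₃)) * ind D ω) ≤
      (prodBernoulli w).real ((openConn a₁ o ∪ (openConn a₂ o ∩ (openConn a₂ a₃)ᶜ)) ∩ (openConn a₁ a₃)ᶜ ∩ openConn a₁ b) := by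
    rw [hreal]
    have step : ∀ ω : BondConfig (Fin n),
        weight w' ω * ind ((openConn a₁ o ∪ (openConn a₂ o ∩ (openConn a₂ a₃)ᶜ)) ∩ (openConn a₁ a₃)ᶜ ∩ openConn a₁ b) ω =
        weight w' ω * ((fB (ω \ {e | ∃ v ∈ e, v = a₃ ∨ ∃ e' ∈ openEdgeCluster ω a₃, v ∈ e'}) *
          fE (ω \ {e | ∃ v ∈ e, v = a₃ ∨ ∃ e' ∈ openEdgeCluster ω a₃, v ∈ e'})) * dD (openEdgeCluster ω a₃)) := by
      intro ω
      rw [hsplit]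
      by_cases hω : ω ∈ D
      · rw [hEpt ω hω, hBpt ω hω, ← hdpt ω]; ring
      · rw [← hdpt ω, ind_of_not_mem hω]; ring
    rw [Finset.sum_congr rfl fun ω _ => step ω, sre_sum_cond_gen w' hm a₃ (fun W ζ => (fB ζ * fE ζ) * dD W)]
    refine Finset.sum_le_sum fun ω _ => mul_le_mul_of_nonneg_left ?_ (weight_nonneg hw0 hw1 ω)
    rw [hdpt ω]
    -- Harris for the fixed deleted set `A = W̄(C₃(ω))`
    set A : Set (Sym2 (Fin n)) := {e | ∃ v ∈ e, v = a₃ ∨ ∃ e' ∈ openEdgeCluster ω a₃, v ∈ e'} with hA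
    have hH := harris hw0 hw1 (f := fun η => fB (η \ A)) (g := fun η => fE (η \ A))
      (fun η => ind_nonneg _ _) (fun η => ind_nonneg _ _)
      (fun η η' h => hfBm (Set.sdiff_subset_sdiff_left h)) (fun η η' h => hfEm (Set.sdiff_subset_sdiff_left h))
    rw [hm, one_mul] at hH
    have hsum : ∑ η, weight w' η * (fB (η \ A) * fE (η \ A) * dD (openEdgeCluster ω a₃)) =
        (∑ η, weight w' η * (fB (η \ A) * fE (η \ A))) * dD (openEdgeCluster ω a₃) := by
      rw [Finset.sum_mul]
      exact Finset.sum_congr rfl fun η _ => by ring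
    rw [hsum]
    exact mul_le_mul_of_nonneg_right hH (ind_nonneg _ _)
  -- μ(R ∩ T) = Σ τ(C₃) 1_D and μ(R) = Σ 1_D
  have hM4 : (prodBernoulli w).real ((openConn a₁ a₃)ᶜ ∩ openConn a₃ b) =
      ∑ ω, weight w' ω * (τ (openEdgeCluster ω a₃) * ind D ω) := by
    rw [hreal]
    refine Finset.sum_congr rfl fun ω _ => ?_
    rw [hsplit', hTpt ω]
  have hM5 : (prodBernoulli w).real ((openConn a₁ a₃)ᶜ : Set (BondConfig (Fin n))) = ∑ ω, weight w' ω * ind D ω := by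
    rw [hreal, hRD]
  -- BHK Thm 1.3 for `C_{a₃}` given `a₃ ↮ a₁`: (i) `e, β` both decreasing; (ii) `τ` increasing, `e` decreasing
  have ha : a₃ ∉ ({a₁} : Set (Fin n)) := by simpa using fun h => h13 h.symm
  have h1 := BHK2006_clusterConditionalPositiveAssociation_holds (Fin n) w a₃ ({a₁} : Set (Fin n))
    (fun W => 1 - eE W) (fun W => 1 - β W) (fun W W' h => by linarith [hea h]) (fun W W' h => by linarith [hβa h]) ha
  have h2 := BHK2006_clusterConditionalPositiveAssociation.antitone_right
    BHK2006_clusterConditionalPositiveAssociation_holds (Fin n) w a₃ ({a₁} : Set (Fin n)) τ eE hτm hea ha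
  rw [hint, hint, hint, hreal] at h1
  rw [hint, hint, hint, hreal] at h2
  -- name the sums
  set P := ∑ ω, weight w' ω * ind D ω with hP
  set Se := ∑ ω, weight w' ω * (eE (openEdgeCluster ω a₃) * ind D ω) with hSe
  set Sb := ∑ ω, weight w' ω * (β (openEdgeCluster ω a₃) * ind D ω) with hSb
  set Seb := ∑ ω, weight w' ω * ((β (openEdgeCluster ω a₃) * eE (openEdgeCluster ω a₃)) * ind D ω) with hSeb
  set Ste := ∑ ω, weight w' ω * ((τ (openEdgeCluster ω a₃) * eE (openEdgeCluster ω a₃)) * ind D ω) with hSte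
  set St := ∑ ω, weight w' ω * (τ (openEdgeCluster ω a₃) * ind D ω) with hSt
  -- linear expansions of the sums in h1
  have x1 : ∑ ω, weight w' ω * ((1 - eE (openEdgeCluster ω a₃)) * ind D ω) = P - Se := by
    rw [hP, hSe, ← Finset.sum_sub_distrib]; exact Finset.sum_congr rfl fun ω _ => by ring
  have x2 : ∑ ω, weight w' ω * ((1 - β (openEdgeCluster ω a₃)) * ind D ω) = P - Sb := by
    rw [hP, hSb, ← Finset.sum_sub_distrib]; exact Finset.sum_congr rfl fun ω _ => by ring
  have x3 : ∑ ω, weight w' ω * ((1 - eE (openEdgeCluster ω a₃)) * (1 - β (openEdgeCluster ω a₃)) * ind D ω) =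
      P - Se - Sb + Seb := by
    rw [hP, hSe, hSb, hSeb, ← Finset.sum_sub_distrib, ← Finset.sum_sub_distrib, ← Finset.sum_add_distrib]
    exact Finset.sum_congr rfl fun ω _ => by ring
  rw [x1, x2, x3] at h1
  have hA1 : Se * Sb ≤ P * Seb := by nlinarith [h1]
  have hA2 : P * Ste ≤ St * Se := by linarith [h2]
  -- nonnegativity
  have hP0 : 0 ≤ P := Finset.sum_nonneg fun ω _ => mul_nonneg (weight_nonneg hw0 hw1 ω) (ind_nonneg _ _)
  -- assemble
  refine ⟨?_, ?_⟩
  · -- (1): μ(E♭R) μ(RB) = Se · Sb ≤ P · Seb ≤ μ(R) · μ(E♭RB)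
    rw [hM0, hM2, hM5]
    calc Se * Sb ≤ P * Seb := hA1
      _ ≤ P * _ := mul_le_mul_of_nonneg_left hM3 hP0
  · -- (2): μ(R) μ(E♭RT) = P · Ste ≤ St · Se = μ(RT) μ(E♭R)
    rw [hM5, hM1, hM4, hM0]
    exact hA2

/-- **`S_E(b) ≥ 0`: `Cov(1_{E♭}, 1{b ∈ C(a₁)} | a₁ ↮ a₃) ≥ 0`, division-free**:
`μ(E♭ ∩ R) μ(R ∩ {a₁↔b}) ≤ μ(R) μ(E♭ ∩ R ∩ {a₁↔b})` for `E♭ = {a₁↔o} ∪ ({a₂↔o} ∩ {a₂↮a₃})`, `R = {a₁↮a₃}`.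
(The observer's "flat" attachment is positively correlated with the target's attachment to the source, in the repeller's world.)
[cite: VandenbergHaggstromKahn2005, Thm. 1.3 (p. 6), Thm. 1.5 (p. 7)] -/
theorem sre_covEflatSource (w : Sym2 (Fin n) → unitInterval) (o b a₁ a₂ a₃ : Fin n) (h13 : a₁ ≠ a₃) (ho2 : o ≠ a₂) :
    (prodBernoulli w).real ((openConn a₁ o ∪ (openConn a₂ o ∩ (openConn a₂ a₃)ᶜ)) ∩ (openConn a₁ a₃)ᶜ) *
        (prodBernoulli w).real ((openConn a₁ a₃)ᶜ ∩ openConn a₁ b) ≤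
      (prodBernoulli w).real ((openConn a₁ a₃)ᶜ : Set (BondConfig (Fin n))) *
        (prodBernoulli w).real ((openConn a₁ o ∪ (openConn a₂ o ∩ (openConn a₂ a₃)ᶜ)) ∩ (openConn a₁ a₃)ᶜ ∩ openConn a₁ b) :=
  (sre_covEflat w o b a₁ a₂ a₃ h13 ho2).1

/-- **`Cov(1_{E♭}, 1{b ∈ C(a₃)} | a₁ ↮ a₃) ≤ 0`, division-free**:
`μ(R) μ(E♭ ∩ R ∩ {a₃↔b}) ≤ μ(R ∩ {a₃↔b}) μ(E♭ ∩ R)` for `E♭ = {a₁↔o} ∪ ({a₂↔o} ∩ {a₂↮a₃})`, `R = {a₁↮a₃}`.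
(The observer's "flat" attachment is negatively correlated with the target's attachment to the repeller.)
[cite: VandenbergHaggstromKahn2005, Thm. 1.3 (p. 6), Thm. 1.5 (p. 7)] -/
theorem sre_covEflatRepeller (w : Sym2 (Fin n) → unitInterval) (o b a₁ a₂ a₃ : Fin n) (h13 : a₁ ≠ a₃) (ho2 : o ≠ a₂) :
    (prodBernoulli w).real ((openConn a₁ a₃)ᶜ : Set (BondConfig (Fin n))) *
        (prodBernoulli w).real ((openConn a₁ o ∪ (openConn a₂ o ∩ (openConn a₂ a₃)ᶜ)) ∩ (openConn a₁ a₃)ᶜ ∩ openConn a₃ b) ≤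
      (prodBernoulli w).real ((openConn a₁ a₃)ᶜ ∩ openConn a₃ b) *
        (prodBernoulli w).real ((openConn a₁ o ∪ (openConn a₂ o ∩ (openConn a₂ a₃)ᶜ)) ∩ (openConn a₁ a₃)ᶜ) :=
  (sre_covEflat w o b a₁ a₂ a₃ h13 ho2).2

end

end Summit.CriticalPhenomena.PercolationContinuityZ3.Theorems
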